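/-
Copyright (c) 2026 the pub-hodgecm-mathlib formalisation cell (harness21).  Prover seat hodgecm-mathlib-K2E3-p06 (g4), Track B «K2-LIT», engine E3, unit U4 «Keys»; deal (D61)
LINE LEAD of the open leaf (U4f-χ₁-ram-one), design D-I v2 (O3) «depth zero = Road II with a character on the Iwahori», step Z2A-1 «THE CHARACTER `χ̃` OF THE IWAHORI» —
generic place-model part; 2026-09-04.  KERNEL module: THEOREMS ONLY (no definition, no named fact, no `sorry`, no instance, no notation).
-/
import Summits.HodgeConjecture.HodgeConjecture.Theorems.K2E3IwahoriFactorisationThree   -- ★ (K2E3-p05 (g2)): `v_apply_zero_zero_eq_one_of_mem_inf` (`|j₀₀| = 1` on `I`); brings ★ `mem_glInt_inf_conj_glInt_iff`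
import HarnessLib

/-!
# K2 ∕ E3 «EllipticInputs», unit U4 «Keys» — (U4f-χ₁-ram-one) step Z2A-1: THE DEPTH-ZERO CHARACTER OF THE IWAHORI SUBGROUP OF `U(σ, Φ₃)(K)` READ OFF THE `(0,0)` ENTRY
# «`j ↦ χ₁(j₀₀)` is multiplicative on `I = K₀ ⊓ K₁` for every `χ₁` trivial on the principal units»   [MoyPrasad1996 §3; Roche1998 §3; BruhatTits1972 (4.4.4); Casselman1995 §1.4]

Cell hodgecm-mathlib (D-0151), FLOOR 0, Track B «K2-LIT», engine E3, crux item H413 = stmt-HodgeConjecture-24833 (route `HCCMUnconditional`, no route verbs); target BY NAME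
the OPEN leaf `…K2E3EllipticInputs.U4Keys.sig_K2E3KeysThmTwoContractingRamifiedCharOne` (U4Keys ED. 7), design D-I v2, plan step Z2A (Branch A), generic part.  Author K2E3-p06 (g4),
line lead (D61).  `--supports stmt-HodgeConjecture-24833 --as helper`; THEOREMS ONLY.  NOT THE PAYER.

THE POINT.  The type vector of ★ (V2b) `exists_typeVector_of_mem_of_factored` needs a function `θ : G → ℂ` MULTIPLICATIVE on the type group `J` and equal to the inducing
character on `J ∩ P`; at DEPTH ZERO (`χ₁` trivial on the principal units `{u : |u − 1| < 1}`) the type group is the IWAHORI `I = K₀ ⊓ K₁` of `U(σ, Φ₃)(K)` (★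
`UnitaryIwahoriSubgroupThree`: `k ∈ I ↔` entries integral and `|k₂₀|, |k₂₁|, |k₁₀| < 1` — upper triangular modulo `𝔭`) and `θ(j) := χ₁(j₀₀)`: the `(0,0)` entry of `j ∈ I` is a UNIT
(★ `K2E3IwahoriFactorisationThree.v_apply_zero_zero_eq_one_of_mem_inf`), and `(j j′)₀₀ = j₀₀ j′₀₀ + j₀₁ j′₁₀ + j₀₂ j′₂₀` differs from `j₀₀ j′₀₀` by an element of `𝔭` (§1), so
`χ₁((jj′)₀₀) = χ₁(j₀₀)χ₁(j′₀₀)` (§2).  On lower unipotents `θ = 1` (`n̄₀₀ = 1`); on upper triangular `p`, `θ(p) = χ₁(p₀₀)` is the inducing character's `χ₁`-part (the CM dress,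
next file, identifies `p₀₀` with `torusEntry 0 (proj p)` ★ `val_proj_borelTriple`).  Everything over a valued field `K` with an isometric `σ`, ANY residue characteristic, tame or
wild — the place model of ★ Road II∕II′.
* §1 `v_mul_apply_zero_zero_sub_lt_one` (`|(jj′)₀₀ − j₀₀j′₀₀| < 1` on `I`; `|j₀₀| = 1` is ★ `v_apply_zero_zero_eq_one_of_mem_inf`).
* §2 `chi_mk0_eq_mul_of_v_sub_lt_one` (a character trivial on principal units is determined modulo `𝔭` on units), **`chi_apply_zero_zero_mul`** (`χ₁((jj′)₀₀) = χ₁(j₀₀)·χ₁(j′₀₀)` on `I`).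
HONEST LABEL: HC_CM is proved only modulo the 7 printed citations (2 remaining named inputs: hLiu418 = stmt-HodgeConjecture-24832, h413 = stmt-HodgeConjecture-24833)
until rung 0 closes; count-neutral — this file does NOT pay the leaf; no printed citation is discharged.

## References
* [MoyPrasad1996] A. Moy, G. Prasad, *Jacquet functors and unrefined minimal K-types*, Comment. Math. Helv. 71 (1996), §3 (depth-zero types `(I, χ̄)`: characters of `I` through `I ↠ I∕I₊ = T(𝔽)`).
* [Roche1998] A. Roche, Ann. Sci. ÉNS (4) 31 (1998), §3 (the character `χ̃` of `J_χ`).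
* [BruhatTits1972] F. Bruhat, J. Tits, Publ. Math. IHÉS 41 (1972), (4.4.4) (the Iwahori subgroup of a rank-one group).
* [Casselman1995] W. Casselman, *Introduction to the theory of admissible representations of `p`-adic reductive groups* (1995), §1.4.
-/

set_option autoImplicit false
-- the mandated namespace has the single-problem summit's repeated segment (`HodgeConjecture.HodgeConjecture`)
set_option linter.dupNamespace false

noncomputable section

open Matrix Literature.NumberTheory.Automorphic Literature.NumberTheory.Automorphic.UnitaryGroup
open scoped Matrix MatrixGroups WithZero

namespace Summit.HodgeConjecture.HodgeConjecture.Cruxes.H413.K2E3DepthZeroIwahoriCharacter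

variable {K : Type*} [Field K] [Valued K ℤᵐ⁰] [ValuativeRel K] [(Valued.v : Valuation K ℤᵐ⁰).Compatible]
  (σ : K →+* K) {ϖ : K} {J : Matrix (Fin 3) (Fin 3) K} (hJ : J = (StdForm.antidiagonal 3).over K)
  (hvσ : ∀ a, Valued.v (σ a) = Valued.v a) (hvϖ : Valued.v ϖ = WithZero.exp (-1 : ℤ))
  (g₁ : GL (Fin 3) K) (hg₁ : (g₁ : Matrix (Fin 3) (Fin 3) K) = Matrix.diagonal ![(1 : K), 1, ϖ])

/-! ## §1 The `(0,0)` entry on the Iwahori is multiplicative modulo `𝔭` -/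

include hJ hvσ hvϖ hg₁ in
/-- **`|(j j′)₀₀ − j₀₀ j′₀₀| < 1` for `j, j′ ∈ I = K₀ ⊓ K₁`**: `(jj′)₀₀ = j₀₀j′₀₀ + j₀₁j′₁₀ + j₀₂j′₂₀` with `|j₀ₖ| ≤ 1` (integrality) and `|j′₁₀|, |j′₂₀| < 1` (★ Iwahori criterion
`mem_glInt_inf_conj_glInt_iff`: `I` is upper triangular modulo `𝔭`). [cite: BruhatTits1972, (4.4.4)] [cite: Casselman1995, §1.4] -/
theorem v_mul_apply_zero_zero_sub_lt_one {j j' : ↥(unitaryGroupOfForm σ J)}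
    (hj : j ∈ (glInt 3 K).subgroupOf (unitaryGroupOfForm σ J) ⊓ ((glInt 3 K).map (MulAut.conj g₁).toMonoidHom).subgroupOf (unitaryGroupOfForm σ J))
    (hj' : j' ∈ (glInt 3 K).subgroupOf (unitaryGroupOfForm σ J) ⊓ ((glInt 3 K).map (MulAut.conj g₁).toMonoidHom).subgroupOf (unitaryGroupOfForm σ J)) :
    Valued.v ((((j * j' : ↥(unitaryGroupOfForm σ J)) : GL (Fin 3) K) : Matrix (Fin 3) (Fin 3) K) 0 0 -
      (((j : GL (Fin 3) K) : Matrix (Fin 3) (Fin 3) K) 0 0) * (((j' : GL (Fin 3) K) : Matrix (Fin 3) (Fin 3) K) 0 0)) < 1 := by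
  obtain ⟨hint, -, -, -⟩ := (mem_glInt_inf_conj_glInt_iff σ hJ hvσ hvϖ g₁ hg₁ j).1 hj
  obtain ⟨-, h20', -, h10'⟩ := (mem_glInt_inf_conj_glInt_iff σ hJ hvσ hvϖ g₁ hg₁ j').1 hj'
  have hmul : (((j * j' : ↥(unitaryGroupOfForm σ J)) : GL (Fin 3) K) : Matrix (Fin 3) (Fin 3) K) 0 0 =
      ∑ k : Fin 3, (((j : GL (Fin 3) K) : Matrix (Fin 3) (Fin 3) K) 0 k) * (((j' : GL (Fin 3) K) : Matrix (Fin 3) (Fin 3) K) k 0) := by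
    rw [Subgroup.coe_mul, Units.val_mul, Matrix.mul_apply]
  rw [hmul, Fin.sum_univ_three, show ∀ a b c d : K, a + b + c - d = (a - d) + (b + c) from fun a b c d => by ring, sub_self, zero_add]
  refine Valued.v.map_add_lt ?_ ?_
  · rw [map_mul]
    calc Valued.v ((((j : ↥(unitaryGroupOfForm σ J)) : GL (Fin 3) K) : Matrix (Fin 3) (Fin 3) K) 0 1) *
          Valued.v ((((j' : ↥(unitaryGroupOfForm σ J)) : GL (Fin 3) K) : Matrix (Fin 3) (Fin 3) K) 1 0)
        ≤ 1 * Valued.v ((((j' : ↥(unitaryGroupOfForm σ J)) : GL (Fin 3) K) : Matrix (Fin 3) (Fin 3) K) 1 0) := by gcongr; exact hint 0 1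
      _ < 1 := by rw [one_mul]; exact h10'
  · rw [map_mul]
    calc Valued.v ((((j : ↥(unitaryGroupOfForm σ J)) : GL (Fin 3) K) : Matrix (Fin 3) (Fin 3) K) 0 2) *
          Valued.v ((((j' : ↥(unitaryGroupOfForm σ J)) : GL (Fin 3) K) : Matrix (Fin 3) (Fin 3) K) 2 0)
        ≤ 1 * Valued.v ((((j' : ↥(unitaryGroupOfForm σ J)) : GL (Fin 3) K) : Matrix (Fin 3) (Fin 3) K) 2 0) := by gcongr; exact hint 0 2
      _ < 1 := by rw [one_mul]; exact h20'

/-! ## §2 The depth-zero character `j ↦ χ₁(j₀₀)` of the Iwahori -/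

omit [ValuativeRel K] [(Valued.v : Valuation K ℤᵐ⁰).Compatible] in
/-- **A character trivial on the principal units is multiplicative modulo `𝔭` on units**: if `|a| = |b| = 1` and `|c − ab| < 1` then `c ≠ 0` and `χ₁(c) = χ₁(a)·χ₁(b)`
(`c = ab·u` with `|u − 1| = |c − ab| < 1`). [cite: MoyPrasad1996, §3] -/
theorem chi_mk0_eq_mul_of_v_sub_lt_one (χ₁ : Kˣ →* ℂˣ) (hdepth : ∀ u : Kˣ, Valued.v ((u : K) - 1) < 1 → χ₁ u = 1)
    {a b c : K} (ha : Valued.v a = 1) (hb : Valued.v b = 1) (hc : Valued.v (c - a * b) < 1)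
    (ha0 : a ≠ 0) (hb0 : b ≠ 0) (hc0 : c ≠ 0) :
    χ₁ (Units.mk0 c hc0) = χ₁ (Units.mk0 a ha0) * χ₁ (Units.mk0 b hb0) := by
  have hab : Valued.v (a * b) = 1 := by rw [map_mul, ha, hb, mul_one]
  -- `u := c ∕ (ab)` is a principal unit
  have hu : Valued.v (((Units.mk0 c hc0 * (Units.mk0 a ha0 * Units.mk0 b hb0)⁻¹ : Kˣ) : K) - 1) < 1 := by
    have hval : ((Units.mk0 c hc0 * (Units.mk0 a ha0 * Units.mk0 b hb0)⁻¹ : Kˣ) : K) = c * (a * b)⁻¹ := by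
      simp only [Units.val_mul, Units.val_inv_eq_inv_val, Units.val_mk0]
    rw [hval, show c * (a * b)⁻¹ - 1 = (c - a * b) * (a * b)⁻¹ by field_simp, map_mul, map_inv₀, hab, inv_one, mul_one]
    exact hc
  have h1 := hdepth _ hu
  rw [map_mul, map_inv, mul_inv_eq_one] at h1
  rw [h1, map_mul]

include hJ hvσ hvϖ hg₁ in
/-- **`θ(j) = χ₁(j₀₀)` IS MULTIPLICATIVE ON THE IWAHORI at depth zero**: for `χ₁ : Kˣ → ℂˣ` trivial on `{u : |u − 1| < 1}` and `j, j′ ∈ I`, `χ₁((jj′)₀₀) = χ₁(j₀₀)·χ₁(j′₀₀)`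
(§1 + ★ `v_apply_zero_zero_eq_one_of_mem_inf` + §2).  This is the character `χ̃` of the depth-zero type `(I, χ̄)` read on the `(0,0)` entry; `χ̃ = 1` on lower unipotents
(`n̄₀₀ = 1`) and `χ̃(p) = χ₁(p₀₀)` on upper triangular `p` (CM dress: `p₀₀ = torusEntry 0 (proj p)`). [cite: MoyPrasad1996, §3] [cite: Roche1998, §3] [cite: Casselman1995, §1.4] -/
theorem chi_apply_zero_zero_mul (χ₁ : Kˣ →* ℂˣ) (hdepth : ∀ u : Kˣ, Valued.v ((u : K) - 1) < 1 → χ₁ u = 1)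
    {j j' : ↥(unitaryGroupOfForm σ J)}
    (hj : j ∈ (glInt 3 K).subgroupOf (unitaryGroupOfForm σ J) ⊓ ((glInt 3 K).map (MulAut.conj g₁).toMonoidHom).subgroupOf (unitaryGroupOfForm σ J))
    (hj' : j' ∈ (glInt 3 K).subgroupOf (unitaryGroupOfForm σ J) ⊓ ((glInt 3 K).map (MulAut.conj g₁).toMonoidHom).subgroupOf (unitaryGroupOfForm σ J))
    (h0 : (((j * j' : ↥(unitaryGroupOfForm σ J)) : GL (Fin 3) K) : Matrix (Fin 3) (Fin 3) K) 0 0 ≠ 0)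
    (h1 : (((j : GL (Fin 3) K) : Matrix (Fin 3) (Fin 3) K) 0 0) ≠ 0) (h2 : (((j' : GL (Fin 3) K) : Matrix (Fin 3) (Fin 3) K) 0 0) ≠ 0) :
    χ₁ (Units.mk0 _ h0) = χ₁ (Units.mk0 _ h1) * χ₁ (Units.mk0 _ h2) :=
  chi_mk0_eq_mul_of_v_sub_lt_one χ₁ hdepth
    (K2E3IwahoriFactorisationThree.v_apply_zero_zero_eq_one_of_mem_inf σ hJ hvσ hvϖ g₁ hg₁ hj)
    (K2E3IwahoriFactorisationThree.v_apply_zero_zero_eq_one_of_mem_inf σ hJ hvσ hvϖ g₁ hg₁ hj')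
    (v_mul_apply_zero_zero_sub_lt_one σ hJ hvσ hvϖ g₁ hg₁ hj hj') h1 h2 h0

include hJ hvσ hvϖ hg₁ in
/-- The `(0,0)` entry of an Iwahori element is NON-ZERO (it is a unit, ★ `v_apply_zero_zero_eq_one_of_mem_inf`). [cite: BruhatTits1972, (4.4.4)] -/
theorem apply_zero_zero_ne_zero_of_mem {j : ↥(unitaryGroupOfForm σ J)}
    (hj : j ∈ (glInt 3 K).subgroupOf (unitaryGroupOfForm σ J) ⊓ ((glInt 3 K).map (MulAut.conj g₁).toMonoidHom).subgroupOf (unitaryGroupOfForm σ J)) :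
    (((j : GL (Fin 3) K) : Matrix (Fin 3) (Fin 3) K) 0 0) ≠ 0 := by
  intro h
  have hv := K2E3IwahoriFactorisationThree.v_apply_zero_zero_eq_one_of_mem_inf σ hJ hvσ hvϖ g₁ hg₁ hj
  rw [h, map_zero] at hv
  exact zero_ne_one hv

end Summit.HodgeConjecture.HodgeConjecture.Cruxes.H413.K2E3DepthZeroIwahoriCharacter

end
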